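import Literature.NumberTheory.EllipticCurves.KrizLi2019.SexticTwistBSDThree
import Literature.NumberTheory.EllipticCurves.BSDQuadraticDescentTorsionOddPartProofs
import Literature.NumberTheory.EllipticCurves.BSDQuadraticDescentShaOddPartGeneralProofs
import Literature.NumberTheory.EllipticCurves.BSDQuadraticDescentArchimedeanProofs
import Literature.NumberTheory.EllipticCurves.BSDQuadraticDescentProofs
import Literature.NumberTheory.EllipticCurves.BSDRootNumberSmallConductorAssemblyProofs
import Literature.NumberTheory.EllipticCurves.ComplexMultiplicationHasCMProofs
import Literature.NumberTheory.EllipticCurves.LeadingTermHeegnerProofs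
import Literature.NumberTheory.EllipticCurves.GrossZagierRationalPoint
import Literature.NumberTheory.EllipticCurves.MordellWeilTheoremProofs
import Literature.NumberTheory.EllipticCurves.RegulatorBasisProofs
import Literature.NumberTheory.EllipticCurves.HeightsBaseChangeProofs
import Literature.NumberTheory.EllipticCurves.ComplexPeriodProofs
import Literature.NumberTheory.EllipticCurves.LFunctionSmulProofs
import HarnessLib

/-!
# The rank-one `3`-part descent `K → ℚ` for Kriz–Li's sextic twists: `BSD(E_d, 3)` over `ℚ`

HONEST FRAMING (cell `b2b-bsdres`, run/shared/lean/b2b/bsd-rank1-residual/; page 1 everywhere):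
prove what is provable now; shrink each hard class to its core with data; no claim beyond stated
classes. The cell deletes the COMBINATION-SHAPED residual classes of the BSD formula in analytic
rank `≤ 1` from PUBLISHED theorems only and TYPES the construction-shaped ones; this is not
"finishing BSD". THIS FILE CONTAINS THEOREMS ONLY (no definition, no new named fact; D-0026 net
debt `0`). It supplies the consumer over `ℚ` that the sibling fact file
`KrizLi2019/SexticTwistBSDThree.lean` (Kriz–Li, Forum Math. Sigma 7 (2019) e15, Thm. 1.23 =
Thm. 10.10: the `3`-part of Gross's index identity for `E_d/K`, tree fact
`thm1010_bsdThree_overK_sexticTwist`, p191197) announced and the cell's referee asked for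
(REFEREE.md gen 61, F48 / R65.3: "KL19 has NO consumer over `ℚ`; the rank-one Milne descent is
UNTYPED — a proposal, not a closure"): the descent of the `3`-part of the Birch–Swinnerton-Dyer
formula from `E_d/K` (analytic rank one over `K`) to the rank-one curve `E_d/ℚ`, i.e. Miller's
`BSD(E_d, 3)` (`Literature.NumberTheory.EllipticCurves.BSDp W 3`), for the sextic twists
`E_d : y² = x³ − 432d` of residual class X12 (CM, `r = 1`, `p = 3` ramified in `ℚ(√−3)`).

## What is proved (`bsdp_three_of_thm1010`)

For `W ≅_ℚ E_d` globally minimal of conductor `N` with `ord_{s=1} L(E_d, s) = 1`, `K` imaginary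
quadratic with the Heegner hypothesis for `3d` and for `N`, `P = P_d ∈ E_d(K)` the Heegner point of
a parametrisation datum `Dt` (Manin constant `c`), Kriz–Li's hypotheses (1)–(4), and a globally
minimal `ℚ`-model `Wd = Cd • W^{(d_K)}` of the quadratic twist: `rank E_d(ℚ) = 1` and `BSDp W 3`,
FROM the published inputs, all named facts of the tree taken as hypotheses —
* Kriz–Li 2019 Thm. 10.10 (`h`), Gross–Zagier 1986 Thm. I.6.3 / V.(2.1) in the form of
  Cai–Shu–Tian 2014 Thm. 1.1 (`hGZ : gross_zagier N W K`), Kolyvagin 1990 Thm. A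
  (`hKo : kolyvagin N W K`), Burungale–Flach 2024 Cor. 2 (`hCM0 : bsdTriple_of_hasCM_of_L_one_ne_zero`,
  full BSD for the CM rank-zero twist), modularity (`hmod : hasEntireLFunction_rat`) —
AND three decidable per-pair side conditions (below). Everything else is PROVED here or already in
the tree: Artin formalism `L(E/K,s) = L(E,s)L(E^{(d_K)},s)` (`LSeries_baseChange_quadratic_holds`,
used through `LDerivEK`/`analyticRankEK_eq_add_of`), the product rule
`L'(E/K,1) = L'(E,1)·L(E^{(d_K)},1)` (`lDerivEK_eq_deriv_mul`), the period relation
`‖ω‖²/√|D| = Ω(E)Ω(E^{(D)})/[E(ℝ):E(ℝ)⁰]` of Gross–Zagier 1986 p. 312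
(`realPeriod_mul_realPeriod_quadraticTwist_eq_mul_bsdPeriod` + `two_mul_covolume_div_sqrt_eq_bsdPeriod`),
the height–index relation in rank one `m·#E(K)_tors²·ĥ_K(P) = 2·[E(K):ℤP]²·Reg(E/ℚ)`, `m ∈ {1,4}`
(§2, from Mordell–Weil, `ĥ_K = 2ĥ_ℚ` and the action of `Gal(K/ℚ)`), and the odd parts of `Ш` and
of the torsion under quadratic base change (Dokchitser–Dokchitser 2010 Lemma 4.14 / Silverman
Ex. 10.16, tree files `BSDQuadraticDescentShaOddPartGeneralProofs`, `…TorsionOddPartProofs`).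

The computation (§5): with `I = [E_d(K):ℤP]`, `t_K, t_W, t_d` the torsion orders of `E_d(K)`,
`E_d(ℚ)` and `#Wd(ℚ)`, `c_W, c_d` the Tamagawa products of `W`, `Wd`, `S_d = #Ш(Wd)`,
`n = [E_d(ℝ):E_d(ℝ)⁰]`, `w = #μ(K)`, `u = u(Cd)`:
`#Ш_an(E_d) = 8 I² t_d² t_W² / (n m t_K² c² w² S_d |u| c_d c_W) ∈ ℚ`, and
`ord₃ #Ш_an(E_d) = ord₃ #Ш(E_d/K) − ord₃ #Ш(Wd) + 2(ord₃ t_d + ord₃ t_W − ord₃ t_K) = ord₃ #Ш(E_d/ℚ)`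
by Kriz–Li's identity `2 ord₃ ∏c_ℓ(E_d) + ord₃ #Ш(E_d/K) = 2 ord₃ I` and the two odd-part
decompositions. This is the descent "BSD(`p`) for `E/K` and for `E^{D}/ℚ` ⇒ BSD(`p`) for `E/ℚ`"
asserted in one sentence by Zhang, Camb. J. Math. 2 (2014), proof of Thm. 10.3, and carried out
"up to `p`-adic units" by Jetchev–Skinner–Wan, Camb. J. Math. 5 (2017), §7.3–§7.4; here exact,
at `p = 3`, for Kriz–Li's curves.

## The three side conditions (hypotheses `htam`, `hu`, `hμ`; per pair, decidable)

* (i) `ord₃ ∏_ℓ c_ℓ(Wd) = ord₃ ∏_ℓ c_ℓ(W)`. In print: at the primes of `3d` (split in `K`)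
  `E_d^{(d_K)} ≅ E_d` over `ℚ_ℓ`; at the primes of `d_K` (where `E_d` is good) `E_d^{(d_K)}` is
  additive with `E_d^{(d_K)}(ℚ_ℓ)[3] = 0` (both characters of `E_d^{(d_K)}[3]^{ss}` are ramified
  there), hence `3 ∤ c_ℓ` — the argument of Kriz–Li's Lemma `lem:tamagawa` (TeX l. 1491–1495);
  cf. Jetchev–Skinner–Wan 2017 §7.3.1 (eq:tamK). Not formalised (the tree's local Tamagawa
  numbers are abstract indices); an engine value per pair.
* (ii) `ord₃ u(Cd) = 0`: the twisted model `W^{(d_K)}` of the minimal `W` is already minimal at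
  `3` (`3 ∤ d_K`, twist by an unramified character at `3`); an engine value per pair.
* (iii) `3 ∤ #μ(K)`, i.e. `K ≠ ℚ(√−3)` — automatic since `3` splits in `K`; kept as a hypothesis.

The Heegner hypothesis is assumed both for `3d` (Kriz–Li's wording) and for `N = N(E_d)` (the
tree's `gross_zagier`/`kolyvagin`); in print these coincide ("`E_d` has additive reduction
exactly at the prime factors of `3d`", Kriz–Li, proof of Thm. 10.6, TeX l. 1401). `r_an(E_d) = 1`
(`hr`) selects the rank-one member of the pair `(E_d, E_d^{(d_K)})`, decided by Kriz–Li's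
Cor. 10.7 congruences. Census reach (HOME/b2b-bsdres-harvest-2/KL19-X12-SEXTIC.md): the 7 X12@3
pairs `225a1, 1323m1, 1728a1, 3888t1, 7803b1, 11907s1, 15129a1` (N < 2·10⁴). FAMILY-shaped; the
label of X12 (CONSTRUCTION) does not change; nothing here is a claim about the other 144 pairs.

## References
* [KrizLi2019] D. Kriz, C. Li, Forum Math. Sigma 7 (2019) e15, Thm. 1.23 = Thm. 10.10, §10.3,
  Lemma `lem:tamagawa`, Cor. 10.7 (= arXiv:1609.06687v3).
* [GrossZagier1986] B. H. Gross, D. B. Zagier, Invent. Math. 84 (1986), Thm. I.6.3, V.(2.1)–(2.2)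
  and the proof of I.(7.3), pp. 310–312 (corpus `paper:url-d19484107fe2` pp. 107–113).
* [CaiShuTian2014] L. Cai, J. Shu, Y. Tian, Algebra Number Theory 8 (2014), Thm. 1.1.
* [Kolyvagin1990] V. A. Kolyvagin, *Euler systems*, Progr. Math. 87 (1990), Thm. A; [Gross1991].
* [BurungaleFlach2024] A. Burungale, M. Flach, Camb. J. Math. 12 (2024), Cor. 2.
* [Miller2011LMS] R. L. Miller, LMS J. Comput. Math. 14 (2011), Def. 1.1.
* W. Zhang, Camb. J. Math. 2 (2014), §10 (Lemma 10.1, proof of Thm. 10.3); D. Jetchev, C. Skinner,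
  X. Wan, Camb. J. Math. 5 (2017), §7.3–§7.4 (the descent bookkeeping in print).
* [SilvermanAEC2009] Thm. VIII.9.3, VIII.6, Exercise 10.16; [DokchitserDokchitserAnnals2010] Lemma 4.14.
-/

noncomputable section

open scoped Classical

open WeierstrassCurve NumberField Literature.NumberTheory.EllipticCurves
  Literature.NumberTheory.EllipticCurves.ModularForms
  Literature.NumberTheory.QuadraticFields

namespace Literature.NumberTheory.EllipticCurves.KrizLi2019

/-! ## §1. Rank-one bookkeeping in `E(K)`: coefficients along a Mordell–Weil generator -/

section RankOne

variable {F : Type} [Field F] [NumberField F] (V : WeierstrassCurve F) [V.IsElliptic]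

/-- **A Mordell–Weil generator in rank one.** If `rank E(F) = 1` there is a point `g` of
infinite order such that every point is `n • g` plus a torsion point with `n` unique (`n • g`
torsion forces `n = 0`), and the regulator is its canonical height:
`Reg(E/F) = det(⟨g, g⟩) = ĥ(g)` (Silverman, *AEC*, VIII.6 `E(F) ≅ E(F)_tors × ℤ^r` with `r = 1`,
and VIII.9, definition of `R_{E/F}`; tree: `exists_isMordellWeilBasis_holds` (Mordell–Weil,
proved), `IsMordellWeilBasis.regulatorOf_eq_regulator`, `heightPairing_self_holds`). [folklore] -/
theorem exists_generator_regulator_eq_of_mordellWeilRank_eq_one (hr : V.mordellWeilRank = 1) :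
    ∃ g : V.toAffine.Point, ¬ IsOfFinAddOrder g ∧
      (∀ x : V.toAffine.Point, ∃ n : ℤ, x - n • g ∈ AddCommGroup.torsion V.toAffine.Point) ∧
      (∀ n : ℤ, n • g ∈ AddCommGroup.torsion V.toAffine.Point → n = 0) ∧
      V.regulator = g.canonicalHeight := by
  obtain ⟨P, hP⟩ : ∃ P : Fin 1 → V.toAffine.Point, IsMordellWeilBasis P := by
    rw [← hr]; exact V.exists_isMordellWeilBasis_holds
  have hreg : regulatorOf P = V.regulator := hP.regulatorOf_eq_regulator
  obtain ⟨hli, hsp⟩ := hP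
  refine ⟨P 0, ?_, ?_, ?_, ?_⟩
  · intro htor
    have h0 : (QuotientAddGroup.mk ∘ P : Fin 1 → mordellWeilModTorsion V) 0 = 0 := by
      simp only [Function.comp_apply]
      exact (QuotientAddGroup.eq_zero_iff _).mpr htor
    exact hli.ne_zero 0 h0
  · intro x
    have hx : (QuotientAddGroup.mk x : mordellWeilModTorsion V) ∈
        Submodule.span ℤ (Set.range (QuotientAddGroup.mk ∘ P : Fin 1 → mordellWeilModTorsion V)) := by
      rw [hsp]; exact Submodule.mem_top
    have hrange : Set.range (QuotientAddGroup.mk ∘ P : Fin 1 → mordellWeilModTorsion V) =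
        {(QuotientAddGroup.mk (P 0) : mordellWeilModTorsion V)} := by
      ext y
      simp only [Set.mem_range, Function.comp_apply, Set.mem_singleton_iff]
      constructor
      · rintro ⟨i, rfl⟩; rw [Subsingleton.elim i 0]
      · rintro rfl; exact ⟨0, rfl⟩
    rw [hrange, Submodule.mem_span_singleton] at hx
    obtain ⟨n, hn⟩ := hx
    refine ⟨n, ?_⟩
    rw [← QuotientAddGroup.eq_zero_iff, QuotientAddGroup.mk_sub, QuotientAddGroup.mk_zsmul, ← hn,
      sub_self]
  · intro n hn
    have h0 : n • (QuotientAddGroup.mk ∘ P : Fin 1 → mordellWeilModTorsion V) 0 = 0 := by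
      simp only [Function.comp_apply]
      rw [← QuotientAddGroup.mk_zsmul]
      exact (QuotientAddGroup.eq_zero_iff _).mpr hn
    by_contra hne
    exact hli.ne_zero 0 (smul_eq_zero_iff_right hne |>.mp h0)
  · rw [← hreg, regulatorOf, Matrix.det_fin_one, heightPairingMatrix_apply]
    exact Affine.Point.heightPairing_self_holds (P 0)

/-- Translation by a torsion point does not change the canonical height:
`ĥ(x + t) = ĥ(x)` for `t ∈ E(F)_tors` (`ĥ(x) = ⟨x, x⟩` and the pairing kills torsion;
Silverman, *AEC*, Thm. VIII.9.3(c)–(d)). [cite: SilvermanAEC2009, Thm. VIII.9.3(c)-(d)] -/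
theorem canonicalHeight_add_of_isOfFinAddOrder (x : V.toAffine.Point) {t : V.toAffine.Point}
    (ht : IsOfFinAddOrder t) : (x + t).canonicalHeight = x.canonicalHeight := by
  rw [← Affine.Point.heightPairing_self_holds (x + t), ← Affine.Point.heightPairing_self_holds x,
    Affine.Point.heightPairing_add_of_isOfFinAddOrder_left x ht,
    Affine.Point.heightPairing_symm, Affine.Point.heightPairing_add_of_isOfFinAddOrder_left x ht]

/-- `ĥ(x) = n² ĥ(g)` when `x ≡ n • g` modulo torsion (quadraticity, Silverman, *AEC*,
Thm. VIII.9.3(b), and torsion-invariance). [cite: SilvermanAEC2009, Thm. VIII.9.3(b)] -/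
theorem canonicalHeight_eq_of_sub_zsmul_mem_torsion {x g : V.toAffine.Point} {n : ℤ}
    (h : x - n • g ∈ AddCommGroup.torsion V.toAffine.Point) :
    x.canonicalHeight = (n : ℝ) ^ 2 * g.canonicalHeight := by
  have ht : IsOfFinAddOrder (x - n • g) := (AddCommGroup.mem_torsion _).mp h
  have hx : x = n • g + (x - n • g) := by abel
  rw [hx, canonicalHeight_add_of_isOfFinAddOrder V (n • g) ht,
    Affine.Point.canonicalHeight_zsmul_holds n g]

omit [NumberField F] [V.IsElliptic] in
/-- **Index of a cyclic subgroup in rank one.** If every point is a multiple of `g` modulo the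
torsion subgroup `T` and `g` has infinite order, then for `x ≡ n • g (mod T)` with `n ≠ 0` the
subgroup `ℤx` has index `[E(F) : ℤx] = |n| · #T` (`E(F)/T ≅ ℤ` via `k ↦ k ḡ`, `ℤx ∩ T = 0`, so
`[E : ℤx] = [E/T : ℤ x̄] · #T`; as `Nat.card`s, both sides `0` if `T` were infinite; elementary,
Silverman, *AEC*, VIII.6). [folklore] -/
theorem index_zmultiples_eq {g x : V.toAffine.Point} (hg : ¬ IsOfFinAddOrder g)
    (hgen : ∀ y : V.toAffine.Point, ∃ m : ℤ, y - m • g ∈ AddCommGroup.torsion V.toAffine.Point)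
    {n : ℤ} (hn : n ≠ 0) (hx : x - n • g ∈ AddCommGroup.torsion V.toAffine.Point) :
    (AddSubgroup.zmultiples x).index = n.natAbs * V.torsionOrder := by
  set T := AddCommGroup.torsion V.toAffine.Point with hT_def
  set H := AddSubgroup.zmultiples x with hH_def
  set π : V.toAffine.Point →+ V.toAffine.Point ⧸ T := QuotientAddGroup.mk' T with hπ_def
  -- `x` has infinite order
  have hxtor : ¬ IsOfFinAddOrder x := by
    intro hfin
    have hmem : n • g ∈ T := by
      have : n • g = x - (x - n • g) := by abel
      rw [this]
      exact T.sub_mem ((AddCommGroup.mem_torsion _).mpr hfin) hx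
    -- `n • g` torsion with `n ≠ 0` forces `g` torsion
    have hng : IsOfFinAddOrder (n • g) := (AddCommGroup.mem_torsion _).mp hmem
    exact hg (isOfFinAddOrder_of_zsmul hn hng)
  -- `H ⊓ T = ⊥`
  have hHT : H ⊓ T = ⊥ := by
    rw [eq_bot_iff]
    intro y hy
    obtain ⟨hyH, hyT⟩ := AddSubgroup.mem_inf.mp hy
    obtain ⟨k, rfl⟩ := AddSubgroup.mem_zmultiples_iff.mp hyH
    have hk : IsOfFinAddOrder (k • x) := (AddCommGroup.mem_torsion _).mp hyT
    by_cases hk0 : k = 0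
    · simp [hk0]
    · exact absurd (isOfFinAddOrder_of_zsmul hk0 hk) hxtor
  -- `[E : H] = [E : H ⊔ T] · [H ⊔ T : H]` and `[H ⊔ T : H] = #T`
  have h1 : H.relIndex (H ⊔ T) * (H ⊔ T).index = H.index :=
    AddSubgroup.relIndex_mul_index le_sup_left
  have h2 : H.relIndex (H ⊔ T) = Nat.card T := by
    rw [AddSubgroup.relIndex_sup_left, ← AddSubgroup.inf_relIndex_right, hHT,
      AddSubgroup.relIndex_bot_left]
  -- `[E : H ⊔ T] = [E/T : π H] = |n|`
  have h3 : (H ⊔ T).index = (H.map π).index := by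
    rw [AddSubgroup.index_map, QuotientAddGroup.ker_mk', QuotientAddGroup.range_mk',
      AddSubgroup.index_top, mul_one]
  -- `E/T ≅ ℤ` via `k ↦ k • ḡ`
  have hπx : π x = n • π g := by
    have : π (x - n • g) = 0 := (QuotientAddGroup.eq_zero_iff _).mpr hx
    rwa [map_sub, map_zsmul, sub_eq_zero] at this
  set e : ℤ →+ V.toAffine.Point ⧸ T := (zmultiplesHom _ (π g)) with he_def
  have he_inj : Function.Injective e := by
    intro a b hab
    have hab' : (a - b) • π g = 0 := by
      simp only [he_def, zmultiplesHom_apply] at hab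
      rw [sub_smul, hab, sub_self]
    have hmem : (a - b) • g ∈ T := by
      rw [← QuotientAddGroup.eq_zero_iff, QuotientAddGroup.mk_zsmul]
      exact hab'
    have : IsOfFinAddOrder ((a - b) • g) := (AddCommGroup.mem_torsion _).mp hmem
    by_contra hne
    exact hg (isOfFinAddOrder_of_zsmul (sub_ne_zero.mpr hne) this)
  have he_surj : Function.Surjective e := by
    intro q
    obtain ⟨y, rfl⟩ := QuotientAddGroup.mk_surjective q
    obtain ⟨m, hm⟩ := hgen y
    refine ⟨m, ?_⟩
    simp only [he_def, zmultiplesHom_apply]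
    have : (QuotientAddGroup.mk (y - m • g) : V.toAffine.Point ⧸ T) = 0 :=
      (QuotientAddGroup.eq_zero_iff _).mpr hm
    rw [QuotientAddGroup.mk_sub, QuotientAddGroup.mk_zsmul, sub_eq_zero] at this
    exact this.symm
  have h4 : (H.map π).index = n.natAbs := by
    have hmap : H.map π = (AddSubgroup.zmultiples n).map e := by
      rw [hH_def, AddMonoidHom.map_zmultiples, AddMonoidHom.map_zmultiples, hπx]
      simp only [he_def, zmultiplesHom_apply]
    rw [hmap, AddSubgroup.index_map_of_bijective ⟨he_inj, he_surj⟩, Int.index_zmultiples]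
  rw [← h1, h2, h3, h4, WeierstrassCurve.torsionOrder, mul_comm]

end RankOne

/-! ## §2. The quadratic extension: `σ` acts trivially on `E(K)/tors` when `rank E(K) = rank E(ℚ) = 1` -/

section Quadratic

variable {F : Type} [Field F] [NumberField F] (W : WeierstrassCurve F) [W.IsElliptic]
  (K : Type) [Field K] [NumberField K] [Algebra F K]

omit [NumberField F] [W.IsElliptic] [NumberField K] in
/-- `E_K` is an elliptic curve (Mathlib's instance for `W.map`, through the `baseChange`
abbreviation). [folklore] -/
theorem isElliptic_baseChange' [W.IsElliptic] : (W.baseChange K).IsElliptic := by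
  rw [WeierstrassCurve.baseChange]; infer_instance

omit [NumberField F] [W.IsElliptic] [NumberField K] in
/-- **`σ`-fixed points of `E(K)` are `F`-rational** (`σ` the conjugation of the quadratic
extension `K = F(θ)`, `2 ≠ 0`): both coordinates are fixed by `σ`, hence in `F`
(`Quadratic.exists_eq_algebraMap_of_conj_eq`). Silverman, *AEC*, Exercise 10.16; the tree's
`QuadraticDescent.mem_range_incl_of_conjMap_eq` is the same statement on the completed-square
model. [cite: SilvermanAEC2009, Exercise 10.16] -/
theorem mem_range_incl_of_map_conj_eq [NeZero (2 : F)] (h2 : Module.finrank F K = 2)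
    {θ : K} {c : F} (hθ : θ ∉ Set.range (algebraMap F K))
    (hc : θ ^ 2 = algebraMap F K c) (P : (W.baseChange K).toAffine.Point)
    (hP : Affine.Point.map (W' := W) (Quadratic.conj h2 hθ hc) P = P) :
    P ∈ (QuadraticDescent.incl K W).range := by
  rcases P with _ | ⟨x, y, h⟩
  · exact AddMonoidHom.mem_range.mpr ⟨0, by rw [map_zero]; rfl⟩
  · rw [Affine.Point.map_some, Affine.Point.some.injEq] at hP
    obtain ⟨a, ha⟩ := Quadratic.exists_eq_algebraMap_of_conj_eq h2 hθ hc hP.1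
    obtain ⟨b, hb⟩ := Quadratic.exists_eq_algebraMap_of_conj_eq h2 hθ hc hP.2
    obtain ⟨Q, hQ⟩ := QuadraticDescent.exists_incl_eq (K := K) W h ha.symm hb.symm
    exact AddMonoidHom.mem_range.mpr ⟨Q, hQ⟩

/-- **Height–index relation for a point of infinite order in rank one over a quadratic field.**
Let `K/F` be a quadratic extension of number fields and `E/F` elliptic with
`rank E(K) = rank E(F) = 1`, and let `P ∈ E(K)` have infinite order. Then
`m · #E(K)_tors² · ĥ_K(P) = 2 · [E(K) : ℤP]² · Reg(E/F)` for some `m ∈ {1, 4}`.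
Here `ĥ_K` is the canonical height over `K` (`= 2 ĥ_F` on `F`-rational points,
`canonicalHeight_baseChange`) and `Reg(E/F) = ĥ_F(g)` for a generator `g` of `E(F)/tors`.
Proof: with `g_K` a generator of `E(K)/tors`, `P ≡ a g_K`, `[E(K):ℤP] = |a|·#E(K)_tors`
(`index_zmultiples_eq`), `g ≡ k g_K`; the conjugation `σ` of `K/F` fixes `g`, so it acts as `+1`
on `E(K)/tors ≅ ℤ`, whence `g_K + σ g_K ≡ 2 g_K` is `F`-rational (`mem_range_incl_of_map_conj_eq`)
and `k ∣ 2`, `m = k²`. This is the bookkeeping "`ĥ(P_K) = [E(K):ℤP_K]²·Reg/…`" of Gross–Zagier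
1986, V.§2 (p. 311) and of Jetchev–Skinner–Wan 2017, §7.4.1 ("`⟨z_K, z_K⟩ = m_K² Reg(E/K)`,
`Reg(E/K) = Reg(E/ℚ)` up to `p`-units"), made exact. [folklore] -/
theorem exists_mul_canonicalHeight_eq_index_sq_mul_regulator (h2 : Module.finrank F K = 2)
    (hrK : (W.baseChange K).mordellWeilRank = 1) (hrQ : W.mordellWeilRank = 1)
    (P : (W.baseChange K).toAffine.Point) (hP : ¬ IsOfFinAddOrder P) :
    ∃ m : ℕ, (m = 1 ∨ m = 4) ∧
      (m : ℝ) * ((W.baseChange K).torsionOrder : ℝ) ^ 2 * P.canonicalHeight =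
        2 * ((AddSubgroup.zmultiples P).index : ℝ) ^ 2 * W.regulator := by
  haveI : (W.baseChange K).IsElliptic := isElliptic_baseChange' W K
  haveI : NeZero (2 : F) := ⟨two_ne_zero⟩
  -- generators over `K` and over `F`
  obtain ⟨gK, hgK, hgenK, huniqK, -⟩ :=
    exists_generator_regulator_eq_of_mordellWeilRank_eq_one (W.baseChange K) hrK
  obtain ⟨g, hg, hgen, huniq, hreg⟩ := exists_generator_regulator_eq_of_mordellWeilRank_eq_one W hrQ
  set T := AddCommGroup.torsion (W.baseChange K).toAffine.Point with hT_def
  set ι : W.toAffine.Point →+ (W.baseChange K).toAffine.Point := QuadraticDescent.incl K W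
    with hι_def
  -- a square-root generator of `K` and the conjugation `σ`
  obtain ⟨θ, c, hθ, hc⟩ := Quadratic.exists_sq_eq_algebraMap (F := F) (K := K) h2
  set σ : (W.baseChange K).toAffine.Point →+ (W.baseChange K).toAffine.Point :=
    Affine.Point.map (W' := W) (Quadratic.conj h2 hθ hc) with hσ_def
  have hσι : ∀ y : W.toAffine.Point, σ (ι y) = ι y := fun y =>
    Affine.Point.map_baseChange (W' := W) (Quadratic.conj h2 hθ hc) y
  have hσσ : ∀ x, σ (σ x) = x := fun x =>
    QuadraticDescent.conjMap_conjMap W (Quadratic.conj_conj h2 hθ hc) x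
  -- `σ` preserves torsion, hence respects congruences modulo `T`
  have hσT : ∀ {x y : (W.baseChange K).toAffine.Point}, x - y ∈ T → σ x - σ y ∈ T := by
    intro x y hxy
    rw [← map_sub]
    exact (AddCommGroup.mem_torsion _).mpr (σ.isOfFinAddOrder ((AddCommGroup.mem_torsion _).mp hxy))
  -- coefficients: `P ≡ a gK`, `ι g ≡ k gK`, `σ gK ≡ e gK`
  obtain ⟨a, ha⟩ := hgenK P
  obtain ⟨k, hk⟩ := hgenK (ι g)
  obtain ⟨e, he⟩ := hgenK (σ gK)
  -- uniqueness of coefficients modulo `T`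
  have hcoef : ∀ {x : (W.baseChange K).toAffine.Point} {u v : ℤ},
      x - u • gK ∈ T → x - v • gK ∈ T → u = v := by
    intro x u v hu hv
    have hmem : (u - v) • gK ∈ T := by
      have : (u - v) • gK = (x - v • gK) - (x - u • gK) := by rw [sub_smul]; abel
      rw [this]; exact T.sub_mem hv hu
    have := huniqK (u - v) hmem
    omega
  -- `a ≠ 0` (P has infinite order) and `k ≠ 0` (ι g has infinite order)
  have ha0 : a ≠ 0 := by
    rintro rfl
    rw [zero_smul, sub_zero] at ha
    exact hP ((AddCommGroup.mem_torsion _).mp ha)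
  have hιg : ¬ IsOfFinAddOrder (ι g) := fun hfin =>
    hg ((Affine.Point.map_injective (W' := W) _).isOfFinAddOrder_iff.mp hfin)
  have hk0 : k ≠ 0 := by
    rintro rfl
    rw [zero_smul, sub_zero] at hk
    exact hιg ((AddCommGroup.mem_torsion _).mp hk)
  -- `e = 1`: apply `σ` to `ι g ≡ k gK`
  have he1 : e = 1 := by
    have h1 : σ (ι g) - k • σ gK ∈ T := by
      have := hσT hk
      rwa [map_zsmul] at this
    rw [hσι] at h1
    -- `ι g ≡ k • σ gK ≡ k e • gK`
    have h2' : ι g - (k * e) • gK ∈ T := by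
      have hke : k • σ gK - (k * e) • gK ∈ T := by
        have : k • σ gK - (k * e) • gK = k • (σ gK - e • gK) := by
          rw [mul_smul, smul_sub]
        rw [this]
        exact T.zsmul_mem he k
      have : ι g - (k * e) • gK = (ι g - k • σ gK) + (k • σ gK - (k * e) • gK) := by abel
      rw [this]; exact T.add_mem h1 hke
    have hkk : k = k * e := hcoef hk h2'
    have : k * (e - 1) = 0 := by linear_combination -hkk
    rcases mul_eq_zero.mp this with h | h
    · exact absurd h hk0
    · linarith
  -- `gK + σ gK` is `ℚ`-rational and `≡ 2 gK`
  have hfix : σ (gK + σ gK) = gK + σ gK := by rw [map_add, hσσ, add_comm]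
  obtain ⟨y, hy⟩ := AddMonoidHom.mem_range.mp
    (mem_range_incl_of_map_conj_eq W K h2 hθ hc (gK + σ gK) hfix)
  obtain ⟨j, hj⟩ := hgen y
  -- `ι y ≡ j • ι g ≡ j k • gK` and `ι y = gK + σ gK ≡ 2 gK`
  have hy1 : ι y - (j * k) • gK ∈ T := by
    have hA : ι y - j • ι g ∈ T := by
      have := ι.isOfFinAddOrder ((AddCommGroup.mem_torsion _).mp hj)
      rw [map_sub, map_zsmul] at this
      exact (AddCommGroup.mem_torsion _).mpr this
    have hB : j • ι g - (j * k) • gK ∈ T := by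
      have : j • ι g - (j * k) • gK = j • (ι g - k • gK) := by rw [mul_smul, smul_sub]
      rw [this]; exact T.zsmul_mem hk j
    have : ι y - (j * k) • gK = (ι y - j • ι g) + (j • ι g - (j * k) • gK) := by abel
    rw [this]; exact T.add_mem hA hB
  have hy2 : ι y - (2 : ℤ) • gK ∈ T := by
    rw [hy]
    have : gK + σ gK - (2 : ℤ) • gK = σ gK - e • gK := by rw [he1, two_zsmul, one_zsmul]; abel
    rw [this]; exact he
  have hjk : j * k = 2 := hcoef hy1 hy2
  -- hence `k² ∈ {1, 4}`
  have hk2 : k ^ 2 = 1 ∨ k ^ 2 = 4 := by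
    have hkdvd : k ∣ 2 := ⟨j, by rw [mul_comm]; exact hjk.symm⟩
    have hkabs : k.natAbs ∣ 2 := by exact_mod_cast Int.natAbs_dvd_natAbs.mpr hkdvd
    have hle : k.natAbs ≤ 2 := Nat.le_of_dvd two_pos hkabs
    have hpos : 0 < k.natAbs := Int.natAbs_pos.mpr hk0
    have hsq : k ^ 2 = (k.natAbs : ℤ) ^ 2 := (Int.natAbs_sq k).symm
    interval_cases h : k.natAbs
    · left; rw [hsq]; norm_num
    · right; rw [hsq]; norm_num
  -- heights: `ĥ(P) = a² ĥ(gK)`, `ĥ(ι g) = k² ĥ(gK) = 2 ĥ_ℚ(g) = 2 Reg`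
  have hhP : P.canonicalHeight = (a : ℝ) ^ 2 * gK.canonicalHeight :=
    canonicalHeight_eq_of_sub_zsmul_mem_torsion (W.baseChange K) ha
  have hhg : (ι g).canonicalHeight = (k : ℝ) ^ 2 * gK.canonicalHeight :=
    canonicalHeight_eq_of_sub_zsmul_mem_torsion (W.baseChange K) hk
  have hhg2 : (ι g).canonicalHeight = 2 * g.canonicalHeight := by
    have h := Affine.Point.canonicalHeight_baseChange (R := F) (K := F) (L := K) (W := W) g
    rw [h2] at h
    exact_mod_cast h
  -- index: `[E(K) : ℤP] = |a| · #T`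
  have hidx : (AddSubgroup.zmultiples P).index = a.natAbs * (W.baseChange K).torsionOrder :=
    index_zmultiples_eq (W.baseChange K) hgK hgenK ha0 ha
  refine ⟨(k ^ 2).toNat, ?_, ?_⟩
  · rcases hk2 with h | h <;> simp [h]
  · have hcast : (((k ^ 2).toNat : ℕ) : ℝ) = (k : ℝ) ^ 2 := by
      have : ((k ^ 2).toNat : ℤ) = k ^ 2 := Int.toNat_of_nonneg (sq_nonneg k)
      exact_mod_cast this
    rw [hcast, hidx, hreg, hhP]
    have hasq : ((a.natAbs : ℕ) : ℝ) ^ 2 = (a : ℝ) ^ 2 := by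
      rw [Nat.cast_natAbs, Int.cast_abs, sq_abs]
    push_cast
    rw [mul_pow]
    have key : (k : ℝ) ^ 2 * gK.canonicalHeight = 2 * g.canonicalHeight := by rw [← hhg, hhg2]
    calc (k : ℝ) ^ 2 * ((W.baseChange K).torsionOrder : ℝ) ^ 2 * ((a : ℝ) ^ 2 * gK.canonicalHeight)
        = ((W.baseChange K).torsionOrder : ℝ) ^ 2 * (a : ℝ) ^ 2 *
            ((k : ℝ) ^ 2 * gK.canonicalHeight) := by ring
      _ = 2 * ((a.natAbs : ℝ) ^ 2 * ((W.baseChange K).torsionOrder : ℝ) ^ 2) *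
            g.canonicalHeight := by rw [key, hasq]; ring

end Quadratic

/-! ## §3. Torsion bookkeeping: `#E(F)[p^∞] = p^{v_p(#E(F)_tors)}` in any rank -/

section Torsion

variable {A : Type*} [AddCommGroup A] (p : ℕ) [hp : Fact p.Prime]

/-- The `p`-primary component of an abelian group is in bijection with the `p`-primary component
of its torsion subgroup (elements of `p`-power order are torsion). [folklore] -/
theorem natCard_primaryComponent_eq_natCard_primaryComponent_torsion :
    Nat.card (AddCommGroup.primaryComponent A p) =
      Nat.card (AddCommGroup.primaryComponent (AddCommGroup.torsion A) p) := by
  refine Nat.card_congr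
    { toFun := fun x => ⟨⟨x.1, ?_⟩, ?_⟩
      invFun := fun y => ⟨(y.1 : A), ?_⟩
      left_inv := fun x => rfl
      right_inv := fun y => rfl }
  · -- `x` is torsion
    obtain ⟨k, hk⟩ := (AddCommGroup.mem_primaryComponent).mp x.2
    exact (AddCommGroup.mem_torsion _).mpr
      (isOfFinAddOrder_iff_nsmul_eq_zero.mpr ⟨p ^ k, pow_pos hp.out.pos k, hk⟩)
  · obtain ⟨k, hk⟩ := (AddCommGroup.mem_primaryComponent).mp x.2
    exact (AddCommGroup.mem_primaryComponent).mpr ⟨k, Subtype.ext (by simpa using hk)⟩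
  · obtain ⟨k, hk⟩ := (AddCommGroup.mem_primaryComponent).mp y.2
    refine (AddCommGroup.mem_primaryComponent).mpr ⟨k, ?_⟩
    have := congrArg (fun z : AddCommGroup.torsion A => (z : A)) hk
    simpa using this

/-- For a group with finite torsion subgroup (e.g. `E(F)` over a number field, any rank):
`#A[p^∞] = p^{v_p(#A_tors)}`. [folklore] -/
theorem natCard_primaryComponent_eq_pow_padicValNat_torsion [Finite (AddCommGroup.torsion A)] :
    Nat.card (AddCommGroup.primaryComponent A p) =
      p ^ padicValNat p (Nat.card (AddCommGroup.torsion A)) := by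
  rw [natCard_primaryComponent_eq_natCard_primaryComponent_torsion p,
    natCard_primaryComponent_eq_pow_padicValNat p]

end Torsion

section TorsionQuadratic

variable {F : Type} [Field F] [NumberField F] (W : WeierstrassCurve F) [W.IsElliptic]
  (K : Type) [Field K] [NumberField K] [Algebra F K]

/-- **The odd part of the torsion under quadratic base change, in valuations, any rank**:
for `K = F(θ)`, `θ² = c`, an `F`-model `Wd` of the twist `W^{(d)}`, `d = c q²`, with `Wd(F)`
finite, and an odd prime `p`: `v_p(#E(K)_tors) = v_p(#E(F)_tors) + v_p(#Wd(F))`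
(`E(K)[p^∞] ≅ E(F)[p^∞] × Wd(F)[p^∞]`, tree theorem
`card_primaryComponent_point_baseChange_quadratic_of_odd`, Silverman *AEC* Ex. 10.16, read on
the finite torsion subgroups). [cite: SilvermanAEC2009, Exercise 10.16] -/
theorem padicValNat_torsionOrder_baseChange_quadratic (h2 : Module.finrank F K = 2)
    {θ : K} {c : F} (hθ : θ ∉ Set.range (algebraMap F K)) (hc : θ ^ 2 = algebraMap F K c)
    {d q : F} (hq : q ≠ 0) (hd : d = c * q ^ 2)
    {Wd : WeierstrassCurve F} (hWd : ∃ C : VariableChange F, C • W.quadraticTwist d = Wd)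
    [Finite Wd.toAffine.Point] (p : ℕ) [Fact p.Prime] (hp : p ≠ 2) :
    padicValNat p (W.baseChange K).torsionOrder =
      padicValNat p W.torsionOrder + padicValNat p (Nat.card Wd.toAffine.Point) := by
  haveI : NeZero (2 : F) := ⟨two_ne_zero⟩
  haveI : (W.baseChange K).IsElliptic := isElliptic_baseChange' W K
  haveI : Finite (AddCommGroup.torsion W.toAffine.Point) := W.finite_torsion_holds
  haveI : Finite (AddCommGroup.torsion (W.baseChange K).toAffine.Point) :=
    (W.baseChange K).finite_torsion_holds
  have hcard := card_primaryComponent_point_baseChange_quadratic_of_odd W h2 hθ hc hq hd hWd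
    (W' := W.baseChange K) ⟨1, one_smul _ _⟩ p hp
  rw [natCard_primaryComponent_eq_pow_padicValNat_torsion p,
    natCard_primaryComponent_eq_pow_padicValNat_torsion p,
    natCard_primaryComponent_eq_pow_padicValNat p, ← pow_add] at hcard
  exact Nat.pow_right_injective (Fact.out : p.Prime).two_le hcard

end TorsionQuadratic

/-! ## §4. Analytic and archimedean inputs over `ℚ` -/

section Analytic

variable (W : WeierstrassCurve ℚ) [W.IsElliptic] (K : Type) [Field K] [NumberField K]

/-- **Product rule for `L'(E/K, 1)`**: with `L(E/K, s) = L(E, s) · L(E^{(d_K)}, s)` (the tree's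
`LDerivEK` is the derivative at `1` of this product of entire continuations) and `L(E, 1) = 0`,
`L'(E/K, 1) = L'(E, 1) · L(E^{(d_K)}, 1)` (Gross–Zagier 1986, V.§2, p. 312: "combine Theorem
(2.1) and … `L(E', 1) = …`"; Jetchev–Skinner–Wan 2017, §7.4.1: "`L'(E/K') = L'(E,1)L(E^{D'},1)`").
Modularity (`hmod`) supplies the differentiability. [cite: GrossZagier1986, V.§2 (p. 312)] -/
theorem lDerivEK_eq_deriv_mul (hmod : hasEntireLFunction_rat) (h0 : W.entireLFunction 1 = 0) :
    LDerivEK W K =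
      deriv W.entireLFunction 1 * (W.quadraticTwist (NumberField.discr K : ℚ)).entireLFunction 1 := by
  have hD : (NumberField.discr K : ℚ) ≠ 0 := by exact_mod_cast NumberField.discr_ne_zero K
  haveI := W.isElliptic_quadraticTwist hD
  have hf : DifferentiableAt ℂ W.entireLFunction 1 :=
    (W.differentiable_entireLFunction (hmod W)).differentiableAt
  have hg : DifferentiableAt ℂ (W.quadraticTwist (NumberField.discr K : ℚ)).entireLFunction 1 :=
    ((W.quadraticTwist _).differentiable_entireLFunction (hmod _)).differentiableAt
  unfold LDerivEK
  rw [deriv_fun_mul hf hg, h0, zero_mul, add_zero]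

/-- In analytic rank `0` the BSD leading coefficient is the value `L(E, 1)`. [folklore] -/
theorem leadingLCoeff_eq_of_analyticRank_eq_zero (V : WeierstrassCurve ℚ) (hr : V.analyticRank = 0) :
    V.leadingLCoeff = V.entireLFunction 1 := by
  simp [WeierstrassCurve.leadingLCoeff, hr]

omit [W.IsElliptic] in
/-- **The Gross–Zagier period is the BSD period of `E_K`.** For a parametrisation datum `Dt`
(whose period pair spans a Néron lattice of the model `W`) and an imaginary quadratic `K`:
`2 covol(Λ_W) / √|d_K| = Ω(W_K/K)` (`bsdPeriod (W.baseChange K)`; one complex place,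
`∫_{E(ℂ)}|ω ∧ ω̄| = 2 covol(Λ_W)`, `complexPeriod_eq_two_mul_covolume'`). This is the
normalisation `‖ω‖² = ∫_{E(ℂ)}|ω ∧ ω̄|` of Gross–Zagier 1986, V.§2 (p. 310).
[cite: GrossZagier1986, V.§2 (p. 310)] -/
theorem two_mul_covolume_div_sqrt_eq_bsdPeriod {N : ℕ} [NeZero N]
    (Dt : ModularParametrizationData W N) [IsTotallyComplex K] (h2 : Module.finrank ℚ K = 2) :
    2 * ZLattice.covolume Dt.L.lattice / √|(NumberField.discr K : ℝ)| =
      (W.baseChange K).bsdPeriod := by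
  obtain ⟨w⟩ : Nonempty (InfinitePlace K) := inferInstance
  have hcard := card_infinitePlace_eq_one_of_finrank_eq_two (K := K) h2
  have hmap : (W.baseChange K).map w.embedding = W.baseChange ℂ := by
    rw [WeierstrassCurve.baseChange, WeierstrassCurve.baseChange, map_map]
    congr 1
    exact Subsingleton.elim _ _
  rw [(W.baseChange K).bsdPeriod_eq_of_card_eq_one hcard w,
    (W.baseChange K).placePeriod_of_isTotallyComplex w, hmap,
    (W.baseChange ℂ).complexPeriod_eq_two_mul_covolume' Dt.isNeronLattice.1 Dt.isNeronLattice.2]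

/-- The number of real components is `1` or `2`. [folklore] -/
theorem numRealComponents_eq_one_or (V : WeierstrassCurve ℚ) :
    (V.baseChange ℝ).numRealComponents = 1 ∨ (V.baseChange ℝ).numRealComponents = 2 := by
  rw [numRealComponents_baseChange_real]
  split_ifs <;> simp

omit [W.IsElliptic] in
/-- A curve `ℚ`-isomorphic to `y² = x³ − 432d` has `c₄ = 0` (all of `a₁, a₂, a₃, a₄` vanish on
that model and `c₄` scales by `u⁻⁴`), hence so has every model of its quadratic twists
(`c₄(C • W^{(D)}) = u⁻⁴ D² c₄(W)`), which therefore have `j = 0` and complex multiplication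
(tree theorem `hasCM_of_j_eq_zero`). [folklore] -/
theorem hasCM_of_twist_of_sextic {d : ℤ}
    (hW : ∃ C : VariableChange ℚ, C • W = ({ a₁ := 0, a₂ := 0, a₃ := 0, a₄ := 0, a₆ := -432 * d } :
      WeierstrassCurve ℚ))
    {D : ℚ} (Wd : WeierstrassCurve ℚ) [Wd.IsElliptic] {Cd : VariableChange ℚ}
    (hWd : Cd • W.quadraticTwist D = Wd) : Wd.HasCM := by
  have hc4 : W.c₄ = 0 := by
    obtain ⟨C, hC⟩ := hW
    have h : (C • W).c₄ = ((C.u⁻¹ : ℚˣ) : ℚ) ^ 4 * W.c₄ := WeierstrassCurve.variableChange_c₄ W C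
    have h0 : (C • W).c₄ = 0 := by
      rw [hC]; simp [WeierstrassCurve.c₄, WeierstrassCurve.b₂, WeierstrassCurve.b₄]
    rw [h0] at h
    rcases mul_eq_zero.mp h.symm with h1 | h1
    · exact absurd h1 (pow_ne_zero _ (Units.ne_zero _))
    · exact h1
  have hd4 : Wd.c₄ = 0 := by
    rw [← hWd, WeierstrassCurve.variableChange_c₄, quadraticTwist_c₄, hc4, mul_zero, mul_zero]
  exact WeierstrassCurve.hasCM_of_j_eq_zero Wd (Wd.j_eq_zero hd4)

end Analytic

/-! ## §5. The descent: Kriz–Li over `K` + Gross–Zagier + Kolyvagin + Burungale–Flach ⇒ `BSD(E_d, 3)` -/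

section Descent

/-- **`BSD(E_d, 3)` over `ℚ` for Kriz–Li's rank-one sextic twists, from published theorems plus
three decidable side conditions.** Let `W ≅_ℚ E_d : y² = x³ − 432d` be globally minimal of
conductor `N`, with `ord_{s=1} L(E_d, s) = 1`, and let `K` be an imaginary quadratic field
satisfying the Heegner hypothesis for `3d` and for `N` (the same condition in print: `E_d` has bad
reduction exactly at the primes of `3d`, Kriz–Li 2019, proof of Thm. 10.6), `P = P_d ∈ E_d(K)` the
Heegner point of a parametrisation datum `Dt` with Manin constant `c = Dt.c`, and `Wd` a globally
minimal `ℚ`-model of the twist `E_d^{(d_K)}` obtained by the change of variables `Cd`. Assume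
Kriz–Li's hypotheses (1)–(4) of Thm. 1.23 = 10.10. INPUTS (named facts of the tree, all
PUBLISHED): `h` = Kriz–Li 2019 Thm. 10.10 (`thm1010_bsdThree_overK_sexticTwist`: the `3`-part of
Gross's index identity over `K`); `hGZ` = the Gross–Zagier formula (GZ86 Thm. I.6.3 / V.(2.1),
Cai–Shu–Tian 2014 Thm. 1.1); `hKo` = Kolyvagin 1990 Thm. A (rank one and finiteness of `Ш(E_d/K)`
from the non-torsion Heegner point); `hCM0` = Burungale–Flach 2024 Cor. 2 (full BSD for the CM
rank-zero twist, `L(E_d^{(d_K)}, 1) ≠ 0`); `hmod` = modularity (BCDT 2001). PROVED here and in the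
tree: Artin formalism / product rule for `L(E/K, s)`, the period relation
`‖ω‖²/√|D| = Ω(E)Ω(E^D)/[E(ℝ):E(ℝ)⁰]` (GZ86 p. 312), the height–index relation (§2), the odd parts
of `Ш` and of the torsion under quadratic base change (Dokchitser–Dokchitser 2010 Lemma 4.14 /
Silverman Ex. 10.16, tree files `BSDQuadraticDescent*Proofs`). SIDE CONDITIONS (per pair,
decidable; engine-checked in HOME/b2b-bsdres-harvest-2/KL19-X12-SEXTIC.md): (i)
`ord₃ ∏_ℓ c_ℓ(Wd) = ord₃ ∏_ℓ c_ℓ(W)` (Tamagawa numbers of the twist: equal at the primes of `3d`,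
which split in `K`, and `3`-adic units at the primes of `d_K`, where `E_d` is good and
`E_d^{(d_K)}(ℚ_ℓ)[3] = 0` — Kriz–Li's Lemma `lem:tamagawa` argument; Jetchev–Skinner–Wan 2017
§7.3.1 (eq:tamK)); (ii) `ord₃ u(Cd) = 0` (the twisted model `W^{(d_K)}` is already minimal at `3`,
as `3 ∤ d_K`); (iii) `3 ∤ #μ(K)` (i.e. `K ≠ ℚ(√−3)`, automatic since `3` splits in `K`).
CONCLUSION: Miller's `BSD(E_d, 3)` for `W` (`BSDp W 3`): `rank E_d(ℚ) = 1 = r_an`, `Ш(E_d/ℚ)[3^∞]`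
finite, `#Ш_an(E_d) ∈ ℚ` with `ord₃ #Ш_an = ord₃ #Ш(E_d/ℚ)[3^∞]`. This is the descent
"BSD(3) for `E_d/K` [+ BSD for `E_d^{(d_K)}/ℚ`] ⇒ BSD(3) for `E_d/ℚ`" (Gross–Zagier 1986 V.§2;
Zhang 2014, proof of Thm. 10.3; Jetchev–Skinner–Wan 2017 §7.4) carried out exactly, at `p = 3`,
for Kriz–Li's curves; residual class X12 of RESIDUAL-CASES §a.2 (CM, `r = 1`, `p = 3` ramified in
`ℚ(√−3)`), sub-population of sextic twists — FAMILY-shaped, the class label does not change.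
[cite: KrizLi2019, Thm. 1.23 = Thm. 10.10 and §10.3] [cite: GrossZagier1986, V.§2 (pp. 310–312)]
[cite: BurungaleFlach2024, Cor. 2] [cite: Miller2011LMS, Def. 1.1] -/
theorem bsdp_three_of_thm1010
    (d : ℤ) (W : WeierstrassCurve ℚ) [W.IsElliptic] [W.IsGloballyMinimal] (N : ℕ) [NeZero N]
    (K : Type) [Field K] [NumberField K]
    (Dt : ModularParametrizationData W N) (H : HeegnerDatum N (NumberField.discr K)) (ι : K →+* ℂ)
    (P : (W.baseChange K).toAffine.Point)
    -- the published inputs (named facts of the tree)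
    (h : thm1010_bsdThree_overK_sexticTwist) (hGZ : gross_zagier N W K) (hKo : kolyvagin N W K)
    (hCM0 : bsdTriple_of_hasCM_of_L_one_ne_zero) (hmod : hasEntireLFunction_rat)
    -- the data: `W ≅ E_d` minimal of conductor `N`, `K` Heegner for `3d` and `N`, `P` the Heegner point
    (hW : ∃ C : VariableChange ℚ, C • W = ({ a₁ := 0, a₂ := 0, a₃ := 0, a₄ := 0, a₆ := -432 * d } :
      WeierstrassCurve ℚ))
    (hN : W.conductorNorm ℤ = N) (hK : IsImaginaryQuadratic K)
    (hH : SatisfiesHeegnerHypothesis (3 * d.natAbs) K) (hHN : SatisfiesHeegnerHypothesis N K)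
    (hP : WeierstrassCurve.Affine.Point.map ι.toRatAlgHom P = heegnerPointComplex Dt H)
    -- Kriz–Li's hypotheses (1)–(4)
    (h1 : (d % 4 = 1 ∧ Squarefree d ∧ d ≠ 1) ∨
      (4 ∣ d ∧ (d / 4 % 4 = 2 ∨ d / 4 % 4 = 3) ∧ Squarefree (d / 4)))
    (h9 : d % 9 = 2 ∨ d % 9 = 3 ∨ d % 9 = 5 ∨ d % 9 = 8)
    (h3pos : 0 < d → ThreeClassNumberTrivial (-3 * d) ∧ ThreeClassNumberTrivial (NumberField.discr K * d))
    (h3neg : d < 0 → ThreeClassNumberTrivial d ∧ ThreeClassNumberTrivial (-3 * NumberField.discr K * d))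
    (h4 : ¬ (3 : ℤ) ∣ Dt.c)
    -- the rank-one member of the pair `(E_d, E_d^{(d_K)})` (Kriz–Li Cor. 10.7 decides which one it is)
    (hr : W.analyticRank = 1)
    -- a globally minimal model of the quadratic twist by `d_K`
    (Wd : WeierstrassCurve ℚ) [Wd.IsElliptic] [Wd.IsGloballyMinimal] (Cd : VariableChange ℚ)
    (hWd : Cd • W.quadraticTwist (NumberField.discr K : ℚ) = Wd)
    -- the three side conditions
    (htam : padicValNat 3 Wd.tamagawaProduct = padicValNat 3 W.tamagawaProduct)
    (hu : padicValRat 3 (Cd.u : ℚ) = 0) (hμ : ¬ 3 ∣ Units.torsionOrder K) :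
    W.mordellWeilRank = 1 ∧ BSDp W 3 := by
  haveI : Fact (Nat.Prime 3) := ⟨Nat.prime_three⟩
  haveI hEK : (W.baseChange K).IsElliptic := isElliptic_baseChange' W K
  obtain ⟨h2, hKtc⟩ := hK
  haveI : IsTotallyComplex K := hKtc
  have hD0 : (NumberField.discr K : ℚ) ≠ 0 := by exact_mod_cast NumberField.discr_ne_zero K
  haveI hEt : (W.quadraticTwist (NumberField.discr K : ℚ)).IsElliptic :=
    W.isElliptic_quadraticTwist hD0
  ---------------------------------------------------------------- Kriz–Li and Kolyvagin
  obtain ⟨hPinf, hrEK, hrkK, hid⟩ :=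
    h d W N K Dt H ι P hW hN ⟨h2, hKtc⟩ hH hP h1 h9 h3pos h3neg h4
  obtain ⟨-, hShaK⟩ := hKo ⟨h2, hKtc⟩ hHN ⟨Dt, H, ι, hP⟩ hPinf
  haveI hfinK : Finite (W.baseChange K).sha := hShaK
  have hKL := hid hfinK
  have hShaW : W.ShaFinite := Literature.NumberTheory.EllipticCurves.shaFinite_of_baseChange W K hShaK
  haveI hfinW : Finite W.sha := hShaW
  ---------------------------------------------------------------- analytic ranks
  have hadd := analyticRankEK_eq_add_of hmod W K
  rw [hrEK, hr] at hadd
  have hrt : (W.quadraticTwist (NumberField.discr K : ℚ)).analyticRank = 0 := by omega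
  have hrd : Wd.analyticRank = 0 := by rw [← hWd, analyticRank_smul, hrt]
  ---------------------------------------------------------------- Burungale–Flach for the twist
  have hcm : Wd.HasCM := hasCM_of_twist_of_sextic W hW Wd hWd
  have hLd0 : Wd.entireLFunction 1 ≠ 0 := (Wd.analyticRank_eq_zero_iff_holds (hmod Wd)).1 hrd
  obtain ⟨hrankd, hShad, hleadd⟩ := (bsdTriple_iff Wd).1 (hCM0 Wd hcm hLd0)
  have hrkd : Wd.mordellWeilRank = 0 := by rw [← hrankd, hrd]
  haveI hfind : Finite Wd.toAffine.Point := Wd.mordellWeilRank_eq_zero_iff_holds.mp hrkd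
  haveI hfinSd : Finite Wd.sha := hShad
  ---------------------------------------------------------------- ranks over `ℚ`
  haveI : Module.Finite ℤ (W.baseChange K).toAffine.Point := (W.baseChange K).module_finite_point_holds
  have hrsum := mordellWeilRank_baseChange_of_finrank_eq_two_of_finite W K h2
  have hrkt : (W.quadraticTwist (NumberField.discr K : ℚ)).mordellWeilRank = 0 := by
    rw [← mordellWeilRank_variableChange_holds (W.quadraticTwist _) Cd, hWd, hrkd]
  have hrQ : W.mordellWeilRank = 1 := by rw [hrkK, hrkt] at hrsum; omega
  refine ⟨hrQ, ?_⟩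
  ---------------------------------------------------------------- heights and index (§2)
  obtain ⟨m, hm, hheight⟩ :=
    exists_mul_canonicalHeight_eq_index_sq_mul_regulator W K h2 hrkK hrQ P hPinf
  ---------------------------------------------------------------- Gross–Zagier and the period
  have hLD := (hGZ ⟨h2, hKtc⟩ hHN) Dt H ι P hP
  have hper := two_mul_covolume_div_sqrt_eq_bsdPeriod W K Dt h2
  have hΩ := W.realPeriod_mul_realPeriod_quadraticTwist_eq_mul_bsdPeriod K h2
  have hΩd : Wd.realPeriodRat =
      |((Cd.u : ℚ) : ℝ)| * (W.quadraticTwist (NumberField.discr K : ℚ)).realPeriodRat := by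
    rw [← hWd]; exact realPeriodRat_smul_holds (W.quadraticTwist _) Cd
  ---------------------------------------------------------------- `L`-values
  have hL0 : W.entireLFunction 1 = 0 := entireLFunction_one_eq_zero_of_analyticRank_eq_one hr
  have hlead : W.leadingLCoeff = deriv W.entireLFunction 1 :=
    (leadingLCoeff_eq_deriv_of_analyticRank_eq_one hr).1
  have hprod := lDerivEK_eq_deriv_mul W K hmod hL0
  have hLt : (W.quadraticTwist (NumberField.discr K : ℚ)).entireLFunction = Wd.entireLFunction := by
    rw [← hWd, entireLFunction_smul]
  have hLd : Wd.entireLFunction 1 =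
      (((Wd.shaOrder : ℝ) * Wd.realPeriodRat * (Wd.tamagawaProduct : ℝ) /
        (Nat.card Wd.toAffine.Point : ℝ) ^ 2 : ℝ) : ℂ) := by
    rw [← leadingLCoeff_eq_of_analyticRank_eq_zero Wd hrd, hleadd, Wd.bsdRHS_eq_of_finite]
  ---------------------------------------------------------------- positivity of everything
  have hΩW : 0 < W.realPeriodRat := W.realPeriodRat_pos_holds
  have hΩt : 0 < (W.quadraticTwist (NumberField.discr K : ℚ)).realPeriodRat :=
    (W.quadraticTwist _).realPeriodRat_pos_holds
  have hR : 0 < W.regulator := W.regulator_pos'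
  have hcW : 0 < W.tamagawaProduct := W.tamagawaProduct_pos_holds
  have hcd : 0 < Wd.tamagawaProduct := Wd.tamagawaProduct_pos_holds
  have htW : 0 < W.torsionOrder := W.torsionOrder_pos_holds
  have htK : 0 < (W.baseChange K).torsionOrder := (W.baseChange K).torsionOrder_pos_holds
  have htd : 0 < Nat.card Wd.toAffine.Point := Nat.card_pos
  have hSd : 0 < Wd.shaOrder := Wd.shaOrder_pos hShad
  have hcM : (Dt.c : ℚ) ≠ 0 := by
    have : Dt.c ≠ 0 := by rintro h0; exact h4 (h0 ▸ dvd_zero 3)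
    exact_mod_cast this
  have hw : 0 < Units.torsionOrder K := Units.torsionOrder_pos K
  have huu : (Cd.u : ℚ) ≠ 0 := Cd.u.ne_zero
  have hm0 : 0 < m := by rcases hm with rfl | rfl <;> norm_num
  have hI0 : (AddSubgroup.zmultiples P).index ≠ 0 := by
    intro hI
    rw [hI] at hheight
    have h0 : (m : ℝ) * ((W.baseChange K).torsionOrder : ℝ) ^ 2 * P.canonicalHeight = 0 := by
      rw [hheight]; simp
    have hh0 : P.canonicalHeight = 0 := by
      rcases mul_eq_zero.mp h0 with h' | h'
      · rcases mul_eq_zero.mp h' with h'' | h''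
        · exact absurd (by exact_mod_cast h'' : m = 0) hm0.ne'
        · exact absurd (pow_eq_zero_iff two_ne_zero |>.mp h'') (by exact_mod_cast htK.ne')
      · exact h'
    exact hPinf ((Affine.Point.canonicalHeight_eq_zero_iff_holds P).mp hh0)
  set n := (W.baseChange ℝ).numRealComponents with hn_def
  have hn : n = 1 ∨ n = 2 := numRealComponents_eq_one_or W
  have hn0 : 0 < n := by rcases hn with h' | h' <;> omega
  ---------------------------------------------------------------- the rational number `q = #Ш_an`
  set I := (AddSubgroup.zmultiples P).index with hI_def
  set q : ℚ := 8 * (I : ℚ) ^ 2 * (Nat.card Wd.toAffine.Point : ℚ) ^ 2 * (W.torsionOrder : ℚ) ^ 2 /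
      ((n : ℚ) * (m : ℚ) * ((W.baseChange K).torsionOrder : ℚ) ^ 2 * (Dt.c : ℚ) ^ 2 *
        (Units.torsionOrder K : ℚ) ^ 2 * (Wd.shaOrder : ℚ) * |(Cd.u : ℚ)| *
        (Wd.tamagawaProduct : ℚ) * (W.tamagawaProduct : ℚ)) with hq_def
  ---------------------------------------------------------------- real abbreviations
  set ΩW := W.realPeriodRat with hΩW_def
  set Ωt := (W.quadraticTwist (NumberField.discr K : ℚ)).realPeriodRat with hΩt_def
  set B := (W.baseChange K).bsdPeriod with hB_def
  set R := W.regulator with hR_def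
  set hh := P.canonicalHeight with hhh_def
  set tK := (W.baseChange K).torsionOrder with htK_def
  set tW := W.torsionOrder with htW_def
  set td := Nat.card Wd.toAffine.Point with htd_def
  set Sd := Wd.shaOrder with hSd_def
  set cdd := Wd.tamagawaProduct with hcdd_def
  set cW := W.tamagawaProduct with hcW_def
  set w := Units.torsionOrder K with hw_def
  set cM := Dt.c with hcM_def
  set u := (Cd.u : ℚ) with hu_def
  have hsqrt : 0 < √|(NumberField.discr K : ℝ)| :=
    Real.sqrt_pos.mpr (abs_pos.mpr (by exact_mod_cast NumberField.discr_ne_zero K))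
  have hΩW' : ΩW = (W.baseChange ℝ).realPeriod := rfl
  have hΩt' : Ωt = ((W.quadraticTwist (NumberField.discr K : ℚ)).baseChange ℝ).realPeriod := rfl
  rw [← hΩW', ← hΩt'] at hΩ
  -- `B = ΩW Ωt / n`, `ĥ = 2 I² R / (m tK²)`, the Gross–Zagier constant `= 4 B / (c² w²)`
  have hBeq : B = ΩW * Ωt / n := by
    rw [hΩ]; field_simp
  have hheq : hh = 2 * (I : ℝ) ^ 2 * R / ((m : ℝ) * (tK : ℝ) ^ 2) := by
    rw [← hheight]; field_simp
  have hGZc : 2 * ZLattice.covolume Dt.L.lattice /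
        ((cM : ℝ) ^ 2 * ((w : ℝ) / 2) ^ 2 * √|(NumberField.discr K : ℝ)|) =
      4 * B / ((cM : ℝ) ^ 2 * (w : ℝ) ^ 2) := by
    rw [← hper]; field_simp; ring
  -- the `L`-values as real numbers
  have hLdr : Wd.entireLFunction 1 = (((Sd : ℝ) * (|(u : ℝ)| * Ωt) * (cdd : ℝ) / (td : ℝ) ^ 2 : ℝ) : ℂ) := by
    rw [hLd, hΩd]
  have hLdne : ((Sd : ℝ) * (|(u : ℝ)| * Ωt) * (cdd : ℝ) / (td : ℝ) ^ 2 : ℝ) ≠ 0 := by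
    have hu' : |(u : ℝ)| ≠ 0 := abs_ne_zero.mpr (by exact_mod_cast huu)
    have hSd'' : (Sd : ℝ) ≠ 0 := by exact_mod_cast hSd.ne'
    have hcd'' : (cdd : ℝ) ≠ 0 := by exact_mod_cast hcd.ne'
    have htd'' : (td : ℝ) ≠ 0 := by exact_mod_cast htd.ne'
    exact div_ne_zero (mul_ne_zero (mul_ne_zero hSd'' (mul_ne_zero hu' hΩt.ne')) hcd'')
      (pow_ne_zero _ htd'')
  set X : ℝ := (4 * B / ((cM : ℝ) ^ 2 * (w : ℝ) ^ 2) * hh) /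
    ((Sd : ℝ) * (|(u : ℝ)| * Ωt) * (cdd : ℝ) / (td : ℝ) ^ 2) with hX_def
  have hL1 : deriv W.entireLFunction 1 = ((X : ℝ) : ℂ) := by
    have hne : (((Sd : ℝ) * (|(u : ℝ)| * Ωt) * (cdd : ℝ) / (td : ℝ) ^ 2 : ℝ) : ℂ) ≠ 0 := by
      exact_mod_cast hLdne
    have key : deriv W.entireLFunction 1 *
        (((Sd : ℝ) * (|(u : ℝ)| * Ωt) * (cdd : ℝ) / (td : ℝ) ^ 2 : ℝ) : ℂ) =
        ((4 * B / ((cM : ℝ) ^ 2 * (w : ℝ) ^ 2) * hh : ℝ) : ℂ) := by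
      rw [← hLdr, ← hLt, ← hprod, hLD, hGZc]
    rw [hX_def, Complex.ofReal_div, ← key, mul_div_cancel_right₀ _ hne]
  have hshaAnR : shaAn W = ((X * (tW : ℝ) ^ 2 / (ΩW * (cW : ℝ) * R) : ℝ) : ℂ) := by
    rw [shaAn_def, hlead, hL1]
    push_cast
    rfl
  have hXq : X * (tW : ℝ) ^ 2 / (ΩW * (cW : ℝ) * R) = (q : ℝ) := by
    have hn' : (n : ℝ) ≠ 0 := by exact_mod_cast hn0.ne'
    have hm' : (m : ℝ) ≠ 0 := by exact_mod_cast hm0.ne'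
    have htK' : (tK : ℝ) ≠ 0 := by exact_mod_cast htK.ne'
    have htW' : (tW : ℝ) ≠ 0 := by exact_mod_cast htW.ne'
    have htd' : (td : ℝ) ≠ 0 := by exact_mod_cast htd.ne'
    have hSd' : (Sd : ℝ) ≠ 0 := by exact_mod_cast hSd.ne'
    have hcd' : (cdd : ℝ) ≠ 0 := by exact_mod_cast hcd.ne'
    have hcW' : (cW : ℝ) ≠ 0 := by exact_mod_cast hcW.ne'
    have hcM' : (cM : ℝ) ≠ 0 := by exact_mod_cast (show cM ≠ 0 by rintro h0; exact h4 (h0 ▸ dvd_zero 3))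
    have hw' : (w : ℝ) ≠ 0 := by exact_mod_cast hw.ne'
    have hu' : |(u : ℝ)| ≠ 0 := abs_ne_zero.mpr (by exact_mod_cast huu)
    have hI' : (I : ℝ) ≠ 0 := by exact_mod_cast hI0
    rw [hX_def, hheq, hBeq, hq_def]
    push_cast
    field_simp
    ring
  have hshaAn : shaAn W = (q : ℂ) := by
    rw [hshaAnR, hXq]; norm_cast
  ---------------------------------------------------------------- `3`-adic valuations
  -- torsion: `v₃(tK) = v₃(tW) + v₃(td)`
  obtain ⟨θ, c, hθ, hc⟩ := Quadratic.exists_sq_eq_algebraMap (F := ℚ) (K := K) h2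
  obtain ⟨qq, hqq, hdq⟩ := NumberField.exists_discr_eq_mul_sq h2 hθ hc
  have htors : padicValNat 3 tK = padicValNat 3 tW + padicValNat 3 td :=
    padicValNat_torsionOrder_baseChange_quadratic W K h2 hθ hc hqq hdq ⟨Cd, hWd⟩ 3 (by norm_num)
  -- `Ш`: `v₃(S_K) = v₃(S_W) + v₃(S_d)`
  have hsha : padicValNat 3 (W.baseChange K).shaOrder = padicValNat 3 W.shaOrder + padicValNat 3 Sd := by
    have hcard := card_primaryComponent_sha_baseChange_quadratic_of_odd_of_finite W K h2 Wd
      ⟨Cd, hWd⟩ (W.baseChange K) ⟨1, one_smul _ _⟩ 3 (by norm_num)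
    rw [WeierstrassCurve.shaOrder, WeierstrassCurve.shaOrder, hSd_def, WeierstrassCurve.shaOrder,
      ← (Nat.pow_right_injective (by norm_num : 2 ≤ 3)).eq_iff, pow_add,
      ← natCard_primaryComponent_eq_pow_padicValNat 3, ← natCard_primaryComponent_eq_pow_padicValNat 3,
      ← natCard_primaryComponent_eq_pow_padicValNat 3]
    exact hcard
  have hshaW : Nat.card (AddCommGroup.primaryComponent W.sha 3) = 3 ^ padicValNat 3 W.shaOrder :=
    natCard_primaryComponent_eq_pow_padicValNat 3
  -- valuation of `q`
  have hI' : (I : ℚ) ≠ 0 := by exact_mod_cast hI0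
  have htd' : (td : ℚ) ≠ 0 := by exact_mod_cast htd.ne'
  have htW' : (tW : ℚ) ≠ 0 := by exact_mod_cast htW.ne'
  have htK' : (tK : ℚ) ≠ 0 := by exact_mod_cast htK.ne'
  have hn' : (n : ℚ) ≠ 0 := by exact_mod_cast hn0.ne'
  have hm' : (m : ℚ) ≠ 0 := by exact_mod_cast hm0.ne'
  have hSd' : (Sd : ℚ) ≠ 0 := by exact_mod_cast hSd.ne'
  have hcd' : (cdd : ℚ) ≠ 0 := by exact_mod_cast hcd.ne'
  have hcW' : (cW : ℚ) ≠ 0 := by exact_mod_cast hcW.ne'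
  have hw' : (w : ℚ) ≠ 0 := by exact_mod_cast hw.ne'
  have hua : |u| ≠ 0 := abs_ne_zero.mpr huu
  have h8 : padicValRat 3 (8 : ℚ) = 0 := by
    rw [show (8 : ℚ) = ((8 : ℕ) : ℚ) by norm_num, padicValRat.of_nat]
    norm_num [padicValNat.eq_zero_of_not_dvd]
  have hvn : padicValRat 3 (n : ℚ) = 0 := by
    rw [padicValRat.of_nat]; rcases hn with h' | h' <;> simp [h', padicValNat.eq_zero_of_not_dvd]
  have hvm : padicValRat 3 (m : ℚ) = 0 := by
    rw [padicValRat.of_nat]; rcases hm with rfl | rfl <;> simp [padicValNat.eq_zero_of_not_dvd]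
  have hvc : padicValRat 3 (cM : ℚ) = 0 := by
    rw [padicValRat.of_int, padicValInt.eq_zero_of_not_dvd h4]; rfl
  have hvw : padicValRat 3 (w : ℚ) = 0 := by
    rw [padicValRat.of_nat, padicValNat.eq_zero_of_not_dvd hμ]; rfl
  have hvu : padicValRat 3 |u| = 0 := by
    rcases abs_choice u with h' | h'
    · rw [h']; exact hu
    · rw [h', padicValRat.neg]; exact hu
  have hval : padicValRat 3 q = padicValNat 3 (Nat.card (AddCommGroup.primaryComponent W.sha 3)) := by
    -- nonvanishing of the partial products
    have hA1 : (8 : ℚ) * (I : ℚ) ^ 2 ≠ 0 := mul_ne_zero (by norm_num) (pow_ne_zero _ hI')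
    have hA2 : (8 : ℚ) * (I : ℚ) ^ 2 * (td : ℚ) ^ 2 ≠ 0 := mul_ne_zero hA1 (pow_ne_zero _ htd')
    have hA3 : (8 : ℚ) * (I : ℚ) ^ 2 * (td : ℚ) ^ 2 * (tW : ℚ) ^ 2 ≠ 0 :=
      mul_ne_zero hA2 (pow_ne_zero _ htW')
    have hD1 : (n : ℚ) * (m : ℚ) ≠ 0 := mul_ne_zero hn' hm'
    have hD2 : (n : ℚ) * (m : ℚ) * (tK : ℚ) ^ 2 ≠ 0 := mul_ne_zero hD1 (pow_ne_zero _ htK')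
    have hD3 : (n : ℚ) * (m : ℚ) * (tK : ℚ) ^ 2 * (cM : ℚ) ^ 2 ≠ 0 :=
      mul_ne_zero hD2 (pow_ne_zero _ hcM)
    have hD4 : (n : ℚ) * (m : ℚ) * (tK : ℚ) ^ 2 * (cM : ℚ) ^ 2 * (w : ℚ) ^ 2 ≠ 0 :=
      mul_ne_zero hD3 (pow_ne_zero _ hw')
    have hD5 : (n : ℚ) * (m : ℚ) * (tK : ℚ) ^ 2 * (cM : ℚ) ^ 2 * (w : ℚ) ^ 2 * (Sd : ℚ) ≠ 0 :=
      mul_ne_zero hD4 hSd'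
    have hD6 : (n : ℚ) * (m : ℚ) * (tK : ℚ) ^ 2 * (cM : ℚ) ^ 2 * (w : ℚ) ^ 2 * (Sd : ℚ) * |u| ≠ 0 :=
      mul_ne_zero hD5 hua
    have hD7 : (n : ℚ) * (m : ℚ) * (tK : ℚ) ^ 2 * (cM : ℚ) ^ 2 * (w : ℚ) ^ 2 * (Sd : ℚ) * |u| *
        (cdd : ℚ) ≠ 0 := mul_ne_zero hD6 hcd'
    have hD8 : (n : ℚ) * (m : ℚ) * (tK : ℚ) ^ 2 * (cM : ℚ) ^ 2 * (w : ℚ) ^ 2 * (Sd : ℚ) * |u| *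
        (cdd : ℚ) * (cW : ℚ) ≠ 0 := mul_ne_zero hD7 hcW'
    have hnum : padicValRat 3 ((8 : ℚ) * (I : ℚ) ^ 2 * (td : ℚ) ^ 2 * (tW : ℚ) ^ 2) =
        2 * padicValNat 3 I + 2 * padicValNat 3 td + 2 * padicValNat 3 tW := by
      rw [padicValRat.mul hA2 (pow_ne_zero _ htW'), padicValRat.mul hA1 (pow_ne_zero _ htd'),
        padicValRat.mul (by norm_num) (pow_ne_zero _ hI'), padicValRat.pow, padicValRat.pow,
        padicValRat.pow, h8, padicValRat.of_nat, padicValRat.of_nat, padicValRat.of_nat]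
      push_cast; ring
    have hden : padicValRat 3 ((n : ℚ) * (m : ℚ) * (tK : ℚ) ^ 2 * (cM : ℚ) ^ 2 * (w : ℚ) ^ 2 *
        (Sd : ℚ) * |u| * (cdd : ℚ) * (cW : ℚ)) =
        2 * padicValNat 3 tK + padicValNat 3 Sd + padicValNat 3 cdd + padicValNat 3 cW := by
      rw [padicValRat.mul hD7 hcW', padicValRat.mul hD6 hcd', padicValRat.mul hD5 hua,
        padicValRat.mul hD4 hSd', padicValRat.mul hD3 (pow_ne_zero _ hw'),
        padicValRat.mul hD2 (pow_ne_zero _ hcM), padicValRat.mul hD1 (pow_ne_zero _ htK'),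
        padicValRat.mul hn' hm', padicValRat.pow, padicValRat.pow, padicValRat.pow,
        hvn, hvm, hvc, hvw, hvu, padicValRat.of_nat, padicValRat.of_nat, padicValRat.of_nat,
        padicValRat.of_nat]
      push_cast; ring
    rw [hshaW, padicValNat.prime_pow, hq_def, padicValRat.div hA3 hD8, hnum, hden]
    have e1 := hKL
    have e2 := htors
    have e3 := hsha
    have e4 := htam
    omega
  exact ⟨by rw [hrQ, hr], inferInstance, q, hshaAn, hval⟩

end Descent

end Literature.NumberTheory.EllipticCurves.KrizLi2019

end
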